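import Mathlib
import HarnessLib
import HarnessLib.Audit
import Summits.Ventures.CertifiedManyBodySolver.HubbardAlg.MbsolverRungLeaves

/-!
Route: M3x2EdgeSplit

# Route M3x2EdgeSplit — the ×2 rung at (8, 7/8, 0) as a declared edge split — certified upper ≤
−73/100 and certified lower ≥ −83/100 decide the split leaf (lower ∧ upper; window width exactly
1/10)

It suffices to show X = UpperEdge_le_m73o100 ∧ LowerEdge_ge_m83o100: at (U, n, t′) = (8, 7/8, 0) the
thermodynamic-limit
energy density e = `energyDensityTT' 1 0 8 (7/8)` has a CERTIFIED UPPER row `e ≤ hi`, `hi ≤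
−73/100`, and a CERTIFIED LOWER row
`lo ≤ e`, `−83/100 ≤ lo`. The pair IS the declared-split ×2 rung leaf
`MbsolverRungLeaves.M3Split_tp0_le_1o10` (:= M3Lower_tp0_ge_m83o100 ∧
M3Upper_tp0_le_m73o100, tree l.300; both conjuncts are verbatim the threshold leaves l.294 / l.287);
its window [−83/100, −73/100] has width
exactly 1/10, so it implies the ∃-window leaf `M3Window_tp0_le_1o10` — classically inhabited,
bookkeeping only; no closure of a window leaf is
rung progress. D-0145 LINES registration (director-hubbard g11; LEAD gen-27 (E5) named the ×2 leaf
and the W = 6 column object U-3 as its upper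
producer; q_L = −83/100 is the LEAD's). HONEST FRAMING: first certified bounds; not a
superconductivity verdict; the LOWER edge is already met
OUTSIDE Lean by CERTIFIED #529 (−0.8295699475 ≥ −0.83, exact rational first-order dual,
interval-checked by the cell) and is a kernel-replay
task; the UPPER edge is NOT met by any dated object (best certified #580 S5-final column-seam W = 4
`COL3ALTR_balW4D1400x0` −25508575947185/2⁴⁵ = −0.7249973, gap 0.0050027, node
`Certificates.m3_tp0_upper_colseam_COL3ALTR_balW4D1400x0_of`, CERTIFIED 2026-08-28 / MOVE 176 —
refreshed 2026-08-29 by the lines seat g7; earlier #550 S4 plaquette-seam v2 −25421994941063/2⁴⁵ =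
−0.7225366 (gap 0.0074634), #547 S3 seam W = 4 −0.7165560;
certified cell [#529, #580] width 0.1045726140 = ×1.05 of this leaf's 1/10); rungs are rungs.
ATTACKED / RESIDUAL (D-0033 header; J S1 supplement sha16 5535cfe04d7c517f, ROUND 1 PASS · FRONTIER,
replayed 2026-08-28T06:51:17Z; director-hubbard ENDORSE REQUESTS l.27442; venture-T1 g9/g10
reading): ATTACKED = the UPPER edge `UpperEdge_le_m73o100` (stmt-Ventures-22023) — producers var /
BD-STRIP / plaquette-seam S3–S5 (best certified #580 hi = −25508575947185/2⁴⁵ = −0.7249973, gap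
0.0050027, node `m3_tp0_upper_colseam_COL3ALTR_balW4D1400x0_of`; supersedes #550 −0.7225366 by
0.0024608; in-scope rung of the attacked conjunct `M3Upper_tp0_floor354_of`; S-case
`M3Upper_tp0_le_m73o100` open; producer verdicts 2026-08-29, FLOAT/EST: the seamed W = 6 TI-cell
class is out of reach (eng-2 g9 l.31010), (U1) W = 8 dressed strips ≈ −0.71…−0.73 at bookable cuts
(var-1 DESIGN-ASK l.30374)); RESIDUAL = the LOWER edge `LowerEdge_ge_m83o100` (stmt-Ventures-22024)
— CERTIFIED #529 lo = −1002888528743611882756433/2⁸⁰ = −0.8295699 ≥ −83/100 (margin 4.3·10⁻⁴) modulo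
kernel replay of its claim node (imported complement, counted once; it stays an item and the
closer-list rung `M3Lower_tp0_ge_m83o100`). JUDGED AGAINST `MbsolverRungLeaves.M3Split_tp0_le_1o10`:
`closes` RE-POINTED there at rev 4 (2026-08-28T06:42Z, alt_closers rung M3w); route OPEN since the
round-1 replay.
Lean: `(∃ hi : ℚ, hi ≤ (-73/100 : ℚ) ∧ Summit.Ventures.CertifiedManyBodySolver.M3EnergyUpperRow 0
hi) ∧ (∃ lo : ℚ, (-83/100 : ℚ) ≤ lo ∧ Summit.Ventures.CertifiedManyBodySolver.M3EnergyLowerRow 0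
lo)`

## Assembly
Pure logic: the deciding theorem is `closes (h₂ : UpperEdge_le_m73o100) (h₃ : LowerEdge_ge_m83o100)
: MbsolverRungLeaves.M3Split_tp0_le_1o10 := ⟨h₃, h₂⟩`
in glue.lean (the split leaf is literally lower ∧ upper). The Assembly item below is the older
implication to the ∃-window leaf as a Prop (witnesses
hi ≤ −73/100 and lo ≥ −83/100 give the triple ⟨lo, hi, lower row, upper row, hi − lo ≤ 1/10⟩ by
`linarith`; exempt, not the deciding theorem).

CLOSES_TARGET: closes rung M3w of Ventures/CertifiedManyBodySolver: Summit.Ventures.CertifiedManyBodySolver.MbsolverRungLeaves.M3Split_tp0_le_1o10 (D-0061; not the summit Statement) — the deciding theorem of this route concludes that registered leaf (Ventures/CertifiedManyBodySolver: no summit Statement) (class rung: servable and labelled, never counted as concluding the summit Statement).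

Rationale: WHY THIS LINE. The ×2 leaf (window ≤ 0.10·t) is the venture's own intermediate rung between the
certified cell (×2.35 [#529, #524] =
[−0.8295699476, −0.7119916754], width 0.1176 at birth; ×2.09 [#529, #580] = [−0.8295699476,
−0.7249973335], width 0.1045726140 since CERTIFIED #580 /
MOVE 176, 2026-08-28T16:53Z — refreshed 2026-08-29 by the lines seat g7) and M3′ (0.05); as typed it
is a window-EXISTENCE sentence and classically
inhabited (density of ℚ; venture Statement D-8; kernel witness in this seat's folder), so the route
DECLARES the split and the
two edges carry the content. The split [−83/100, −73/100] is the cheapest honest one: the LOWER edge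
−0.83 sits 0.0004 below the
certified lower of record, so that half is certificate REPLAY (the cell's interval checker → a Lean
proof of
`M3EnergyLowerRow 0 q₅₂₉`, q₅₂₉ = −1002888528743611882756433/2⁸⁰), and the whole remaining distance
(0.018 below the best certified
upper, 0.0075 below the S4 plaquette-seam FLOAT) is put on the UPPER edge, where the open-strip
float ladder prices it: width-6 open
strips reach −0.734…−0.739 per site (var TILING-CEILING v0.3, FLOAT), i.e. the W = 6 column-MPS
object (LEAD U-3, S1 bd-strip W = 6)
or a seam-dressed W = 4 tiling with 2-D seam correlations is the intended witness [birth text;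
PRODUCER DATA 2026-08-29, FLOAT/EST, mbsolver INBOX
l.30120 / l.30139 / l.30374 / l.31010: the BD-STRIP W = 6 TI cell + one plaquette-seam layer
projects to ≈ −0.7205 ± 0.002 dressed at D → ∞ (banked
cells ≥ −0.716 FLOAT) and cannot reach S5 #580, let alone −0.73 — the −0.734…−0.739 figure is the
infinite-open-strip model e_TL + 0.165/w, not the
producers' seamed TI cell; the seam-dressed W = 4 line delivered #550 −0.7225 and #580 −0.7250
CERTIFIED; the object in reach for the last 0.005 is
var-1's (U1) W = 8 dressed strip (≈ −0.71…−0.73 at bookable cuts, best corner −0.730…−0.734 [EST],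
behind a 2–3 seat-day streamed exact reader);
var-1 g28's W = 6 DECISION WORD l.31011 (07:20Z 08-29, mechanical under (a′)/(b) on that line) =
(b): NO deeper W = 6 pair is bought — deepest banked
cell −0.7107084 FLOAT, short of the −0.716 trigger by 5.29e-3], transported by the cell's
dressed-box tiling
limit (`Upper.DressedBoxTiling.energyDensityTT'_le_of_tiling_rat`, Ruelle1969 §3.3). Float TL
reference e = −0.767 ± 0.004
(ZhengEtAl2017; LeBlancEtAl2015) lies 0.037 below the upper edge and 0.063 above the lower edge.
Imported: Ruelle open-cluster
transport (upper); translation-invariant moment/SOS relaxation with exact rational dual rounding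
(Han2020Bootstrap §3, WangEtAl2024)
for the replay (lower). Relative to route M3PrimeEdgeSplit (same point, split [−4/5, −3/4]) this is
the EASIER rung with a
different upper object class (at birth: W = 6 suffices here, W ≥ 12 there; 2026-08-29 producer EST:
W = 8 dressed is marginal for
−0.73 here, W ≈ 12–16 dressed for −3/4 there) — a separate route because the decls and producers
differ.

RANKED CRUXES. #2 UpperEdge_le_m73o100 (crux) — some certified thermodynamic-limit UPPER row at (8,
7/8, 0) at or below −73/100: ∃ hi ∈ ℚ, hi ≤ −73/100 ∧ e(1,0,8,7/8) ≤ hi. Intended producers (LEAD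
(E5)): U-3 S1 bd-strip W = 6 column-MPS (float class −0.734…−0.739 at birth = infinite-strip model;
producer verdict 2026-08-29: seamed W = 6 TI cells ≥ −0.716 FLOAT, dressed ≈ −0.7205 [EST] — out of
reach, l.31010), U-2 S4 plaquette-seam W = 4 (−0.7225365534 CERTIFIED #550, short by 0.0074634), U-5
S5-final column-seam W = 4 (−0.7249973335 CERTIFIED #580, short by 0.0050027), (U1) W = 8 dressed
strips (≈ −0.71…−0.73 at bookable cuts [EST], var-1 DESIGN-ASK l.30374), seam-dressed 32 × 4k
tilings with correlated seams; all-k families transported by `energyDensityTT'_le_of_tiling_rat`.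
[difficulty: L] (why it might fail: needs −0.018 beyond the best certified upper (S3 seam W=4,
−0.7166) and −0.0075 beyond the S4 plaquette-seam FLOAT; W=6 column states reach −0.734…−0.739 only
in FLOAT DMRG — certifying them at bond dimension χ ≤ 512 in exact arithmetic may lose > 0.005/site.
[2026-08-29: needs −0.0050027 beyond CERTIFIED #580; the W = 6 TI-cell class is measured out of
reach; W = 8 dressed ≈ −0.72…−0.73 at reachable cuts [EST] — marginal.]) [ZhengEtAl2017,
LeBlancEtAl2015, Ruelle1969, QinEtAl2020]
#3 LowerEdge_ge_m83o100 (crux) — some certified thermodynamic-limit LOWER row at (8, 7/8, 0) at or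
above −83/100: ∃ lo ∈ ℚ, −83/100 ≤ lo ∧ lo ≤ e(1,0,8,7/8). Met outside Lean by CERTIFIED #529 (q₅₂₉
= −0.8295699476,
`Certificates.cert_r529_HYB_GU8n7o8eom8_w3_b4_R2_ob5p2_kry1_kry2c3rel_menu_core_focert_it2000` +
`m3_tp0_lower_r529_of`); the Lean content is the kernel/interval REPLAY of that first-order dual
certificate (1.7 M multipliers) or of a smaller edition that still clears −0.83 (margin 0.0004 — a
slimmer certificate at −0.8299 would NOT do). [difficulty: M] (why it might fail: the margin over
#529 is 4·10⁻⁴: any re-rounding, multiplier pruning or smaller replayable edition can land below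
−0.83; a kernel replay of a 1.7M-multiplier PSD certificate has never been done in this tree
(interval Cholesky of 10⁴-size blocks).) [Han2020Bootstrap, WangEtAl2024, Hastings2022]

TWO-LAYER PLAN. Foreseen (BC3 birth skeletons, nothing filed now): UpperEdge_le_m73o100 ⇐
StripFamily_le_m73o100 (a certified all-k open a × (k·b)
family at filling exactly 7/8 with k-free endpoint ≤ −73/100 — the shape of #354/#524's
`cert_dbt299…_allk` nodes) → TilingTransport
(`energyDensityTT'_le_of_tiling_rat`, provable now); LowerEdge_ge_m83o100 ⇐ Row529Replay
(`M3EnergyLowerRow 0 q₅₂₉` as a theorem)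
→ `⟨q₅₂₉, by norm_num, ·⟩` (provable now). Dated rungs docketed as informal rank-9 support after
open: U-3 `m3_upper_S1_bdstrip_W6`,
U-2 `m3_upper_S4_plaqseam_W4`, U-1 `m3_upper_S3_bdstripseam_W4` (mileposts toward the upper edge,
not cone pieces; typed on route (a) M3PrimeEdgeSplit as
asides stmt-Ventures-22472 S3 −3151446772679/2⁴² / 22478 S4 = #550 / 22798 S5 = #580
−25508575947185/2⁴⁵ / 22479 S1 W6-A −835760963/1.2·10⁹ — shared
dated rungs, not re-filed here).

KILL CRITERIA. A certified LOWER row with lo > −73/100 refutes UpperEdge_le_m73o100 (and contradicts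
every float method); a certified UPPER row
with hi < −83/100 refutes LowerEdge_ge_m83o100 and CERTIFIED #529 with it — either closes the route
`refuted:<Decl>`. If the
W = 6 column class certifies above −0.73 (exact-arithmetic loss > 0.009/site at feasible χ), pivot
the upper half to seam-dressed
tilings / W = 8 or supersede by a route with split [−0.825, −0.725] once a lower edition passes
−0.825. [2026-08-29: the W = 6 pivot condition is met on producer FLOAT/EST data (l.31010; var-1 g28
W = 6 DECISION WORD l.31011 = (b): no deeper W = 6 pair bought) — the upper half now rides on the
seam-dressed W = 4 line (#580, 0.005 short) and (U1) W = 8 dressed strips; no lower edition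
passes −0.825 (best #529 −0.8296; hub-lb E2α −0.8271953864 refereed in pub/hub-lb, not a HOME row),
so no re-split is proposed.] Proving route
M3PrimeEdgeSplit's cruxes moots this route (−3/4 ≤ −0.73 and −4/5 ≥ −0.83 imply both edges): close
`superseded`.

NOT DECOMPOSED YET. The certificate format for W = 6 column-MPS families (exact rational MPS tensors
vs interval-rounded DMRG tensors); whether the
last 0.005 comes from deeper seam dressing of the W = 4 line or from (U1) W = 8 dressed strips
behind a streamed exact reader (var-1 DESIGN-ASK
l.30186 / l.30374) — producer-side questions, not decomposed here.

CHEAPEST FALSIFIER. Lookup, run by this seat: (i) the leaf AS TYPED is classically inhabited —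
`LinesSeatAudit.M3Window_tp0_le_1o10_vacuous` (folder
Sketch.lean, rc 0, no certificate used), so the content is the two edges; (ii) is either edge
already crossed the wrong way by a
certified row? No: CERTIFIED.md 2026-08-29 (597 rows; re-dated by the lines seat g7) has lower #529
−0.8295699476 (≥ −0.83 ✓, margin 0.0004) and upper #580
−0.7249973335 (needs −0.0050027; #550 −0.7225 / #524 −0.7120 earlier); float e = −0.767 ± 0.004 is
inside [−0.83, −0.73] with margins 0.063/0.037. The cheapest kill of the UPPER crux's
producers is the W = 6 open-strip DMRG float itself: if the best W = 6 column energy at 7/8 is above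
−0.73 + (certification
loss), the named object cannot work (var TILING-CEILING v0.3 gives −0.734…−0.739: alive by
0.004–0.009). [2026-08-29: for the producers' seamed W = 6 TI cells this kill
HAS FIRED on FLOAT/EST data — banked cells ≥ −0.716, dressed ≈ −0.7205 (eng-2 g9 l.31010; var-1
l.30139); it retires the U-3 object for this crux, not
the crux (float e₀ ≈ −0.767 ≤ −0.73).]

NUMBERS. Split [−83/100, −73/100], width 1/10; refreshed 2026-08-29 by the lines seat g7. Lower of
record #529: −1002888528743611882756433/2⁸⁰ =
−0.8295699476 (margin to −0.83: +0.00043; node `Certificates.m3_tp0_lower_r529_of`). Upper of record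
#580 S5-final multi-layer column-seam W = 4
`COL3ALTR_balW4D1400x0`: −25508575947185/2⁴⁵ = −0.7249973335 (gap to −0.73: 0.0050027; node
`m3_tp0_upper_colseam_COL3ALTR_balW4D1400x0_of` from the open
claim node `cert_colseam_COL3ALTR_balW4D1400x0_allmk`; CERTIFIED 2026-08-28T16:53Z,
sr-mbsolver-ref-12 g31 R12.29, MOVE 176; two-sided with #529 by name
`m3_tp0_row_r529_colseam_COL3ALTR_balW4D1400x0_of`, width 126420533058077496662353/2⁸⁰ =
0.1045726140 = ×1.05 of this leaf's 1/10 (×2.09 of M3′;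
midpoint −0.7773); the window leaf `M3Window_tp0_le_1o8` re-closed from it is bookkeeping, not rung
progress). Earlier uppers: #550 S4 plaquette-seam
W = 4 −25421994941063/2⁴⁵ = −0.7225365534 CERTIFIED (gap 0.0074634; node
`m3_tp0_upper_plaqseam_plaqW4D1400_x01_of`), #547 S3 seam W = 4 −0.7165560356
(gap 0.0134), #524 RS −12525490015723/2⁴⁴ = −0.7119916754 (gap 0.0180; upper of record at birth).
Open-strip MODEL floats w = 4/6/8: −0.726 /
−0.734…−0.739 / −0.742…−0.746 (infinite open strips, e_TL + 0.165/w, TILING-CEILING v0.3) versus the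
producers' seamed TI cells: W = 4 dressed −0.7250
CERTIFIED; W = 6 banked ≥ −0.716 FLOAT, dressed ≈ −0.7205 ± 0.002 [EST] (eng-2 g9 l.31010); W = 8
dressed ≈ −0.71…−0.73 at bookable cuts, −0.72…−0.74
at D → ∞ [EST] (var-1 DESIGN-ASK l.30374, eng-1 g13 l.30136); (A′) dbt2@BAL-twin −0.7156931161 FLOAT
(var-4 g19, class closed). Float TL e = −0.767 ± 0.004
(ZhengEtAl2017). Printed SDP lower K = 7: −0.867 (Han2020Bootstrap).

DEFINITION REQUESTS. None.

Novelty: Searches (2026-08-27, shared with route M3PrimeEdgeSplit): `lit search --hybrid "rigorous certified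
two-sided bounds ground state
energy doped Hubbard model thermodynamic limit semidefinite" -n 8` (none a certified doped 2-D TL
window); `lit galaxy search
"bootstrap|Hubbard model|lower bound" --star all` (noise); `lit galaxy search "bootstrapping the
Hubbard|many-body bootstrap|certified
lower bound on the ground" --star pdf` (arXiv:2507.02386, float); tree `ledger route closers
--problem Ventures` (leaf registered, rung M3w).
Nearest prior art found: the programme's rows #529/#524, route R2cOpenStripTangentLine (−18/25 upper
leaf), Han2020Bootstrap
(arXiv:2006.06002), WangEtAl2024 (arXiv:2310.05844).
Delta: the ×2 rung typed as a decided pair of declared thresholds with the lower half pinned to an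
existing certificate; a
registration (crew rung route), not a mechanism.
Claimed grade: known  [refs: 2507.02386, 2006.06002, 2310.05844, WangEtAl2024]

Barriers (technique_class: certified-upper-bound, sdp-lower-bound, cluster-tiling): - technique_class: certified-upper-bound, sdp-lower-bound, cluster-tiling
- Literature.Barriers.HubbardSuperconductivity.SignProblemNPHard: outside its class — explicit
variational state with exact Rayleigh quotient (upper), exact rational dual functional (lower);
nothing is sampled.
- Literature.Barriers.HubbardSuperconductivity.DegreeFourSosMissesSecondOrderPerturbation: inside
its class for the LOWER half but not biting: −0.83 is 0.063 below e and is already reached by the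
cell's degree-4+fragments relaxation (#529); the item is replay, not improvement.
- Literature.Barriers.HubbardSuperconductivity.PureModelStripeCompetition: prices the UPPER crux
only (stripe-aware supercells; ≈0.01t near-degeneracy inside the 0.037 margin).
- Literature.Barriers.HubbardSuperconductivity.EnergyWindowCeilingResolution: not applicable (no
observable ceiling claimed).
- Literature.Barriers.HubbardSuperconductivity.OrderParameterInvisibleToGroundStateConstraints:
conceded, irrelevant (energies only).
- Negatives index: `ledger negatives --problem Ventures` — no refuted statement concerns an (8, 7/8,
0) energy threshold.

History (route lifecycle, newest last):
- 2026-08-28T06:40:52Z · closes_target -> closes rung M3w of Ventures/CertifiedManyBodySolver: Summit.Ventures.CertifiedManyBodySolver.MbsolverRungLeaves.M3Split_tp0_le_1o10 (D-0061; not the summit Statement) (planner-hubbard-m3-lines-1-g3-0)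

sub-problem: CertifiedManyBodySolver · status: open · opened planner-hubbard-m3-lines-1-g0-0 2026-08-27T20:30:53Z · rev 8 · ledger route-Ventures-M3x2EdgeSplit
GENERATED by the gate from the ledger (D-0016/17). Provers cite these decls: `theorem foo : Summit.Ventures.CertifiedManyBodySolver.Theses.M3x2EdgeSplit.<Decl> := …` in Summits/Ventures/CertifiedManyBodySolver/Theorems/<Name>.lean.
-/

namespace Summit.Ventures.CertifiedManyBodySolver.Theses.M3x2EdgeSplit

open scoped BigOperators Topology Manifold Classical MeasureTheory ProbabilityTheory Matrix InnerProductSpace ComplexConjugate ContinuousMap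
open Filter Set Function TopologicalSpace MeasureTheory

-- H21.Audit: Ventures rung route — no summit Statement decl; the expected conclusion is the closer leaf tagged below
attribute [summit_statement] _root_.Summit.Ventures.CertifiedManyBodySolver.MbsolverRungLeaves.M3Split_tp0_le_1o10

/-- item stmt-Ventures-22023 · crux · rank 2 · open · by planner
why it might fail: needs −0.018 beyond the best certified upper (S3 seam W=4, −0.7166) and −0.0075 beyond the S4 plaquette-seam FLOAT; W=6 column states reach −0.734…−0.739 only in FLOAT DMRG — certifying them at bond dimension χ ≤ 512 in exact arithmetic may lose > 0.005/site.
sources: ZhengEtAl2017, LeBlancEtAl2015, Ruelle1969, QinEtAl2020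
[crux] some certified thermodynamic-limit UPPER row at (8, 7/8, 0) at or below −73/100: ∃ hi ∈ ℚ, hi
≤ −73/100 ∧ e(1,0,8,7/8) ≤ hi. Intended producers (LEAD (E5)): U-3 S1 bd-strip W = 6 column-MPS
(float class −0.734…−0.739), U-2 S4 plaquette-seam W = 4 (−0.7225 FLOAT, short by 0.0075),
seam-dressed 32 × 4k tilings with correlated seams; all-k families transported by
`energyDensityTT'_le_of_tiling_rat`. [difficulty: L] -/
@[route_item "route-Ventures-M3x2EdgeSplit"]
def UpperEdge_le_m73o100 : Prop :=
  ∃ hi : ℚ, hi ≤ (-73/100 : ℚ) ∧ Summit.Ventures.CertifiedManyBodySolver.M3EnergyUpperRow 0 hi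

/-- item stmt-Ventures-22024 · crux · rank 3 · open · by planner
why it might fail: the margin over #529 is 4·10⁻⁴: any re-rounding, multiplier pruning or smaller replayable edition can land below −0.83; a kernel replay of a 1.7M-multiplier PSD certificate has never been done in this tree (interval Cholesky of 10⁴-size blocks).
sources: Han2020Bootstrap, WangEtAl2024, Hastings2022
[crux] some certified thermodynamic-limit LOWER row at (8, 7/8, 0) at or above −83/100: ∃ lo ∈ ℚ,
−83/100 ≤ lo ∧ lo ≤ e(1,0,8,7/8). Met outside Lean by CERTIFIED #529 (q₅₂₉ = −0.8295699476,
`Certificates.cert_r529_HYB_GU8n7o8eom8_w3_b4_R2_ob5p2_kry1_kry2c3rel_menu_core_focert_it2000` +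
`m3_tp0_lower_r529_of`); the Lean content is the kernel/interval REPLAY of that first-order dual
certificate (1.7 M multipliers) or of a smaller edition that still clears −0.83 (margin 0.0004 — a
slimmer certificate at −0.8299 would NOT do). [difficulty: M] -/
@[route_item "route-Ventures-M3x2EdgeSplit"]
def LowerEdge_ge_m83o100 : Prop :=
  ∃ lo : ℚ, (-83/100 : ℚ) ≤ lo ∧ Summit.Ventures.CertifiedManyBodySolver.M3EnergyLowerRow 0 lo

/-- item stmt-Ventures-22025 · assembly · rank 1 · closed · proved by Summit.Ventures.CertifiedManyBodySolver.Theorems.m3x2EdgeSplitAssembly_proof (prover) · by planner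
sources: Ruelle1969, Han2020Bootstrap
[assembly] UpperEdge_le_m73o100 → LowerEdge_ge_m83o100 → M3Window_tp0_le_1o10. -/
@[route_item "route-Ventures-M3x2EdgeSplit"]
def Assembly : Prop :=
  UpperEdge_le_m73o100 → LowerEdge_ge_m83o100 → Summit.Ventures.CertifiedManyBodySolver.MbsolverRungLeaves.M3Window_tp0_le_1o10

-- `Assembly` holds: proved by `Summit.Ventures.CertifiedManyBodySolver.Theorems.m3x2EdgeSplitAssembly_proof` (its module imports this route file, so no `_holds` link can be stated here).

/-! D-0027 §2.1 — DECIDING THEOREM (planner-authored via `route open/edit --closes-file`; by planner-hubbard-m3-lines-1-g3-0 2026-08-28T06:40:52Z):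
its hypotheses are this route's items and its conclusion the registered leaf `Summit.Ventures.CertifiedManyBodySolver.MbsolverRungLeaves.M3Split_tp0_le_1o10` (rung M3w, D-0061) (glue_lint), and it elaborates with this file. -/

@[closes "route-Ventures-M3x2EdgeSplit"] theorem closes (h₂ : UpperEdge_le_m73o100) (h₃ : LowerEdge_ge_m83o100) :
    Summit.Ventures.CertifiedManyBodySolver.MbsolverRungLeaves.M3Split_tp0_le_1o10 :=
  ⟨h₃, h₂⟩

end Summit.Ventures.CertifiedManyBodySolver.Theses.M3x2EdgeSplit
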